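import Summits.QuantumFields.YangMills.Theorems.BalabanUVNodesN15TwoSpacingGluingNeumannKnitEntryOne
import HarnessLib

/-!
# THE GLUING STEP AT TWO LATTICE SPACINGS, XLIII: ENTRY 1 OF THE COVER's PARAMETRIX ON THE DOUBLED TORUS, TWO GRIDS — `𝔇(∇′_μG₀′, ∇_μG₀)` HAS THE RATE `(L^k)^{−1∕16}`,
# FROM dag-n15-a's CUT CUBE ROWS AND DEFECTS (dag-n15-c g13, FILE 85; N15 = NE2, s1 «background-layer OPERATOR ingredient»)

Cell `pub-ymgap`, seat `pub-ymgap-dag-n15-c` (R134 (a); HUMAN RULING D-0062), generation 13.  `bears_on: R4∕N15 · K3⁷ SpineGivenEndpointR13SepCoPH (stmt-QuantumFields-20544)`.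
Filed `--supports stmt-QuantumFields-20544 --as helper` — COUNT-NEUTRAL.  Theorems only (0 `def`, 0 `sorry`).  Imports BY NAME FILE 84 (through it FILE 83's cut-row editions, FILE 80,
FILES 66–79 and dag-n15-a's PROGRAMME N); nothing in the tree is modified.  (Split from FILE 84 for the 400-line limit: §§1–2 there, §3 here.)

WHAT.  Doubled torus `M = MP (paramsOf d L (m+1) k hL)`, FILE 70's cover (cubes `□_k` of side `L·L^m`, Neumann propagators `knitG`, partition `knitH`), coarse `n = L^k`, fine
`n′ = L^r·L^k`, King's pairing `P`, the parametrices `G₀ = Σ_k M_{h_k}G(□_k)M_{h_k}` at both spacings, the forward difference `∇_μ = fgrad n (bshiftEquiv μ)`: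
(FILE 84: §1 partition side — ★ `coverH_shift_cut` (`M_{h_k∘e_μ}∘M_{χ_□} = M_{h_k∘e_μ}`), ★ `abs_coverH_shift_fine_sub_le` (two-grid fit of the SHIFTED partition function: `|h′_k(e′_μx′) −
  h_k(e_μ πx′)| ≤ π(d+1)∕(nw) + (π∕w)∕n′ + (π∕w)∕n`, from `h(ex) = h(x) + n⁻¹∇h(x)`), ★ `entryOneDefectConst_le` (compression of FILE 83's constant to `≤ D·(L^k)^{−1∕16}`);
§2 ★★★ `hasMaj_grad_parametrix_knit` — `∃ δ A > 0 ∀ m k r μ (k ≥ 1): ∇′_μ∘G₀′ ≤ A·e^{−δ|y−y′|_T}` (fine member, blocks through the pairing): FILE 83 `hasMaj_comp_parametrix_cut`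
  with Leibniz `fgrad_comp_mulOp`, the cuts `coverH_shift_cut` ∕ FILE 65 `fgrad_hcube_cut`, the cut rows N-IIIb (`hasMaj_chiCube_symOp_comp` ∘ `hasMaj_comp_mulOp_chiInt`) and N
  `hasMaj_chiCube_grad_neumannCubeG_fine`, FILE 67's `|∇h| ≤ π∕w`, FILE 66's overlap `(2L)^{d+1}`.)
* THIS FILE, §3 ★★★ **`hasMaj_idef_grad_parametrix_knit`** — `∃ δ D > 0 ∀ m k r μ (k ≥ 1, 4 ≤ L^k): 𝔇(∇′_μG₀′, ∇_μG₀) ≤ D(L^k)^{−1∕16}e^{−δ|y−y′|_T}`: FILE 83 `hasMaj_idef_comp_parametrix_cut`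
  with both spacings' cut rows (N-IIIb∕N-IIIc, the `_fine` rows), cut defects N-IIc `hasMaj_idef_chiCube_neumannCubeG` (γ = 1∕8) and N-IIe `hasMaj_idef_chiCube_grad_neumannCubeG`,
  the fits FILE 67 `abs_coverH_fine_sub_le`, §1, FILE 64 `abs_fgrad_hcube_two_grid_le`.
FILES 84 + 85 are the entry-1 rows of FILE 50's `GluedLetters` for the glued `U ≡ 1` family of the cover (the `D′∘G₀′` majorant and the `𝔇(D′G₀′, DG₀)` defect).

HONEST FRAMING ∕ LIMITS.  Block-majorant bookkeeping over LANDED rows at `U ≡ 1` on the doubled-cube torus MODEL (cube = half torus; Neumann-by-images cubes); no new analytic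
estimate.  Nothing of [B5]∕[B6]∕[B9] asserted: [B6] (2.133)–(2.136) p.247 and [B9] Thm 3.14 pp.426–427 are SHAPES ∕ the difference TEMPLATE.  NE2⁺ NOT PRINTED, NOT proved; N15 NOT
discharged; counts of record UNMOVED (typed 28∕28 · discharged 5∕27); one finite 𝕋⁴ at fixed ε per index — NOT infinite volume, NOT OS on ℝ⁴, NOT a mass gap, NOT Clay; R4 closes
the conditional finite-𝕋⁴ rung `BalabanLadder.UV` only.  Restate-immune (no Theses import).
-/

noncomputable section

namespace Summit.QuantumFields.YangMills.BalabanUVNodes.N15.Gluing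

open Real
open Literature.MathematicalPhysics.QuantumFieldTheory.Balaban1983to89
open Literature.MathematicalPhysics.QuantumFieldTheory.Balaban1983to89.B5Prop11Plancherel (Tor fine)
open Literature.MathematicalPhysics.QuantumFieldTheory.Balaban1983to89.B11SectG (BlockNorm HasMaj RowSum)
open Literature.MathematicalPhysics.QuantumFieldTheory.Balaban1983to89.T4EtaRateDefect (idef)
open Literature.MathematicalPhysics.QuantumFieldTheory.Balaban1983to89.T4EtaRateCoeffDefect (pull)
open Literature.MathematicalPhysics.QuantumFieldTheory.Balaban1983to89.B6Prop26Gluing (mulOp mulOp_apply ind ind_nonneg ind_le_one)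
open Literature.MathematicalPhysics.QuantumFieldTheory.Balaban1983to89.B6UnitTorusCarrier (unitTorusGeo triangle254_unitTorusGeo rowSum_unitTorusGeo unitTorusGeo_dist_nonneg
  unitTorusGeo_dist_self)
open Literature.MathematicalPhysics.QuantumFieldTheory.Balaban1983to89.B5SiteBridgeP12 (MP)
open Literature.MathematicalPhysics.QuantumFieldTheory.King1986.Torus (blockOf tdistT tdistT_nonneg)
open Summit.QuantumFields.YangMills.BalabanUVNodes.N15.VectorPiece (bshiftEquiv kingPrV blkFine)
open Summit.QuantumFields.YangMills.BalabanUVNodes.N15.BackgroundLayer (fgrad fgrad_apply symbOp_sD_eq)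
open Summit.QuantumFields.YangMills.BalabanUVNodes.N15.TwoGrid (paramsOf deltaOp gOp neumannCubeG chiCube cubeBlocks ineq110_114_pair hasMaj_gOp_of_ineq hasMaj_chiCube_symOp_comp
  hasMaj_comp_mulOp_chiInt hasMaj_chiCube_grad_neumannCubeG hasMaj_chiCube_grad_neumannCubeG_fine hasMaj_idef_chiCube_neumannCubeG hasMaj_idef_chiCube_grad_neumannCubeG)

variable {d : ℕ}

/-! ## §3 The two-grid defect `𝔇(∇′_μG₀′, ∇_μG₀)` -/

section TwoGrid

variable {L : ℕ} [NeZero L]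

/-- ★★★ **THE TWO-GRID η-DEFECT OF ENTRY 1 OF THE COVER's PARAMETRIX ON THE DOUBLED TORUS**: for odd `L ≥ 3`, `a > 0` there are `δ, D > 0` (uniform in `m, k, r, μ`) with
`𝔇(∇′_μ∘G₀′, ∇_μ∘G₀) ≤ D·(L^k)^{−1∕16}·e^{−δ|y−y′|_T}` for `k ≥ 1`, `4 ≤ L^k` — FILE 83 `hasMaj_idef_comp_parametrix_cut` with every row a tree theorem (cut rows N-IIIb∕c at both
spacings, cut defects N-IIc∕N-IIe, the partition's fits FILE 67 ∕ §1 ∕ FILE 64). [cite: Balaban1984PropagatorsII, (2.133), (2.136) p.247 (shapes), (2.36)–(2.37) p.229;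
Balaban1985BackgroundPropagators, Thm 3.14 pp.426–427 (difference template); King1986, Prop. 3.9 (3.73) p.665 (rate shape)] -/
theorem hasMaj_idef_grad_parametrix_knit (hL : Odd L ∧ 1 < L) {a : ℝ} (ha : 0 < a) :
    ∃ δ D : ℝ, 0 < δ ∧ 0 < D ∧ ∀ (m kk r : ℕ) (_hk : 1 ≤ kk) (_hn4 : 4 ≤ L ^ kk) (μ : Fin (d + 1)),
      HasMaj (BlockNorm.ofBlocks (unitTorusGeo L kk (MP (paramsOf d L (m + 1) kk hL)))
          (fun b : Tor (fine (L ^ kk) (MP (paramsOf d L (m + 1) kk hL))) × Fin (d + 1) => blockOf (L ^ kk) (MP (paramsOf d L (m + 1) kk hL)) b.1))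
        (BlockNorm.ofBlocks (unitTorusGeo L kk (MP (paramsOf d L (m + 1) kk hL)))
          (fun i : Tor (fine (L ^ r * L ^ kk) (MP (paramsOf d L (m + 1) kk hL))) × Fin (d + 1) => blockOf (L ^ r * L ^ kk) (MP (paramsOf d L (m + 1) kk hL)) i.1))
        (idef (pull (kingPrV L kk r (MP (paramsOf d L (m + 1) kk hL)))) (pull (kingPrV L kk r (MP (paramsOf d L (m + 1) kk hL))))
          (fgrad ((L ^ r * L ^ kk : ℕ) : ℝ) (bshiftEquiv (MP (paramsOf d L (m + 1) kk hL)) (L ^ r * L ^ kk) μ) ∘ₗ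
            parametrix (knitH d L m kk (L ^ r * L ^ kk) hL) (knitG d L m kk (L ^ r * L ^ kk) hL a))
          (fgrad ((L ^ kk : ℕ) : ℝ) (bshiftEquiv (MP (paramsOf d L (m + 1) kk hL)) (L ^ kk) μ) ∘ₗ
            parametrix (knitH d L m kk (L ^ kk) hL) (knitG d L m kk (L ^ kk) hL a)))
        (fun y y' => D * ((L ^ kk : ℕ) : ℝ) ^ (-(1 / 16 : ℝ)) * Real.exp (-(δ * tdistT (MP (paramsOf d L (m + 1) kk hL)) y y'))) := by
  have hL3 : 3 ≤ L := by obtain ⟨⟨j, hj⟩, h1⟩ := hL; omega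
  have hLpos : 0 < L := by omega
  have hL1 : 1 ≤ L := hLpos
  have hLodd : Odd L := hL.1
  have hL2 : 2 ≤ L := hL.2
  -- the letters
  obtain ⟨δ₀, C, Cα, Cε, Cαε, hδ₀, hC, H⟩ := ineq110_114_pair (d := d) hL ha
  obtain ⟨δD, βD, hδD, hβD, HD⟩ := hasMaj_chiCube_grad_neumannCubeG (d := d) hL ha
  obtain ⟨δD', βD', hδD', hβD', HD'⟩ := hasMaj_chiCube_grad_neumannCubeG_fine (d := d) hL ha
  obtain ⟨δc, mc, hδc, hmc, HC⟩ := hasMaj_idef_chiCube_neumannCubeG (d := d) hLodd hL2 ha (γ := 1 / 8) (by norm_num) (by norm_num)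
  obtain ⟨δe, me, hδe, hme, HE⟩ := hasMaj_idef_chiCube_grad_neumannCubeG (d := d) hLodd hL2 ha
  set δ : ℝ := min (min δ₀ (min δD δD')) (min δc δe) with hδ_def
  have hδ : 0 < δ := lt_min (lt_min hδ₀ (lt_min hδD hδD')) (lt_min hδc hδe)
  have hd0 : δ ≤ δ₀ := (min_le_left _ _).trans (min_le_left _ _)
  have hdD : δ ≤ δD := (min_le_left _ _).trans ((min_le_right _ _).trans (min_le_left _ _))
  have hdD' : δ ≤ δD' := (min_le_left _ _).trans ((min_le_right _ _).trans (min_le_right _ _))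
  have hdc : δ ≤ δc := (min_le_right _ _).trans (min_le_left _ _)
  have hde : δ ≤ δe := (min_le_right _ _).trans (min_le_right _ _)
  set β : ℝ := 2 ^ (d + 1) * (C * Real.exp δ₀) with hβ_def
  have hβ : 0 ≤ β := by positivity
  set β₁ : ℝ := max βD βD' with hβ₁_def
  have hβ₁ : 0 ≤ β₁ := hβD.le.trans (le_max_left _ _)
  set Nov : ℝ := (((2 * L) ^ (d + 1) : ℕ) : ℝ) with hNov_def
  set Ko : ℝ := π * (d + 1) with hKo_def
  set Kos : ℝ := π * (d + 1) + π + π with hKos_def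
  set Kod : ℝ := 64 * π ^ 2 + π ^ 2 * (d + 1 : ℕ) with hKod_def
  set D : ℝ := Nov * ((β₁ * Ko + me + Kos * β₁) + (π * β * Ko + π * mc + Kod * β)) + 1 with hD_def
  refine ⟨δ, D, hδ, by positivity, fun m kk r hk hn4 μ => ?_⟩
  -- the index's data
  set M : Fin (d + 1) → ℕ := MP (paramsOf d L (m + 1) kk hL) with hMdef
  have hM : ∀ ν, M ν = 2 * L * L ^ m := MP_succ_eq L m kk hL
  have hM' : ∀ ν, M ν = 2 * (L * L ^ m) := fun ν => by rw [hM ν, mul_assoc]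
  have hw : 0 < L ^ m := pow_pos hLpos m
  have hn : 1 ≤ L ^ kk := Nat.one_le_pow _ _ hLpos
  have hn' : 1 ≤ L ^ r * L ^ kk := Nat.one_le_iff_ne_zero.mpr (Nat.mul_ne_zero (pow_ne_zero r (NeZero.ne L)) (pow_ne_zero kk (NeZero.ne L)))
  have hfit := coverMargin_fit hL3 m
  have hfit1 : coverMargin L m + 2 * L ^ m + 1 ≤ L * L ^ m := by omega
  have hS : L * L ^ m ≤ 2 * L * L ^ m := by rw [mul_assoc]; omega
  have hSe : L ^ (m + 1) = L * L ^ m := by rw [pow_succ, mul_comm]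
  have h3 : 3 ≤ L ^ kk * L ^ m :=
    calc 3 ≤ L := hL3
      _ = L ^ 1 := (pow_one L).symm
      _ ≤ L ^ kk := Nat.pow_le_pow_right hLpos hk
      _ = L ^ kk * 1 := (mul_one _).symm
      _ ≤ L ^ kk * L ^ m := Nat.mul_le_mul_left _ hw
  have hwR : (1 : ℝ) ≤ ((L ^ m : ℕ) : ℝ) := by exact_mod_cast hw
  have hnR : (1 : ℝ) ≤ ((L ^ kk : ℕ) : ℝ) := by exact_mod_cast hn
  have hnn' : ((L ^ kk : ℕ) : ℝ) ≤ ((L ^ r * L ^ kk : ℕ) : ℝ) := by exact_mod_cast Nat.le_mul_of_pos_left (L ^ kk) (pow_pos hLpos r)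
  set ε : ℝ := ((L ^ kk : ℕ) : ℝ) ^ (-(1 / 16 : ℝ)) with hε_def
  obtain ⟨hnε, hnwε, hw1, hε0⟩ := rpow_sixteenth_facts hnR hwR
  have hexp16 : (-((1 : ℝ) / 8 / 2)) = -(1 / 16 : ℝ) := by norm_num
  have hblk : (fun i : Tor (fine (L ^ r * L ^ kk) M) × Fin (d + 1) => blockOf (L ^ r * L ^ kk) M i.1) =
      (fun b : Tor (fine (L ^ kk) M) × Fin (d + 1) => blockOf (L ^ kk) M b.1) ∘ kingPrV L kk r M := (VectorPiece.blkFine_comp_kingPrV (M := M) L kk r).symm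
  have hind : ∀ (k : Fin (d + 1) → ZMod (2 * L)) (y y' : Tor M),
      0 ≤ ind (g := unitTorusGeo L kk M) ((cubeBlocks M (coverCorner M (L ^ m) L (coverMargin L m) k) (L * L ^ m) : Finset (Tor M)) : Set (Tor M)) y *
        ind (g := unitTorusGeo L kk M) ((cubeBlocks M (coverCorner M (L ^ m) L (coverMargin L m) k) (L * L ^ m) : Finset (Tor M)) : Set (Tor M)) y' :=
    fun k y y' => mul_nonneg (ind_nonneg _ _) (ind_nonneg _ _)
  -- cut rows at both spacings
  have hG := hasMaj_gOp_of_ineq (L := L) (k := kk) M (L ^ kk) a hn (H (m + 1) kk r hk).1 hC.le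
  have hG' := hasMaj_gOp_of_ineq (L := L) (k := kk) M (L ^ r * L ^ kk) a hn' (H (m + 1) kk r hk).2 hC.le
  have hGc : ∀ k : Fin (d + 1) → ZMod (2 * L),
      HasMaj (BlockNorm.ofBlocks (unitTorusGeo L kk M) (fun b : Tor (fine (L ^ kk) M) × Fin (d + 1) => blockOf (L ^ kk) M b.1))
        (BlockNorm.ofBlocks (unitTorusGeo L kk M) (fun b : Tor (fine (L ^ kk) M) × Fin (d + 1) => blockOf (L ^ kk) M b.1))
        (mulOp (chiCube M (L ^ kk) (coverCorner M (L ^ m) L (coverMargin L m) k) (L * L ^ m)) ∘ₗ knitG d L m kk (L ^ kk) hL a k)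
        (fun y y' => ind ((cubeBlocks M (coverCorner M (L ^ m) L (coverMargin L m) k) (L * L ^ m) : Finset (Tor M)) : Set (Tor M)) y *
          ind ((cubeBlocks M (coverCorner M (L ^ m) L (coverMargin L m) k) (L * L ^ m) : Finset (Tor M)) : Set (Tor M)) y' * (β * Real.exp (-(δ * tdistT M y y')))) := fun k =>
    hasMaj_rate_le (hind k) hβ hd0
      (hasMaj_chiCube_symOp_comp (L := L) (k := kk) (c := coverCorner M (L ^ m) L (coverMargin L m) k) (S := L * L ^ m) hC.le hδ₀.le hM'
        (hasMaj_comp_mulOp_chiInt (c := coverCorner M (L ^ m) L (coverMargin L m) k) (S := L * L ^ m) hC.le hG))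
  have hGc' : ∀ k : Fin (d + 1) → ZMod (2 * L),
      HasMaj (BlockNorm.ofBlocks (unitTorusGeo L kk M) ((fun b : Tor (fine (L ^ kk) M) × Fin (d + 1) => blockOf (L ^ kk) M b.1) ∘ kingPrV L kk r M))
        (BlockNorm.ofBlocks (unitTorusGeo L kk M) ((fun b : Tor (fine (L ^ kk) M) × Fin (d + 1) => blockOf (L ^ kk) M b.1) ∘ kingPrV L kk r M))
        (mulOp (chiCube M (L ^ r * L ^ kk) (coverCorner M (L ^ m) L (coverMargin L m) k) (L * L ^ m)) ∘ₗ knitG d L m kk (L ^ r * L ^ kk) hL a k)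
        (fun y y' => ind ((cubeBlocks M (coverCorner M (L ^ m) L (coverMargin L m) k) (L * L ^ m) : Finset (Tor M)) : Set (Tor M)) y *
          ind ((cubeBlocks M (coverCorner M (L ^ m) L (coverMargin L m) k) (L * L ^ m) : Finset (Tor M)) : Set (Tor M)) y' * (β * Real.exp (-(δ * tdistT M y y')))) := fun k => by
    rw [← hblk]
    exact hasMaj_rate_le (hind k) hβ hd0
      (hasMaj_chiCube_symOp_comp (L := L) (k := kk) (c := coverCorner M (L ^ m) L (coverMargin L m) k) (S := L * L ^ m) hC.le hδ₀.le hM'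
        (hasMaj_comp_mulOp_chiInt (c := coverCorner M (L ^ m) L (coverMargin L m) k) (S := L * L ^ m) hC.le hG'))
  have hDGc : ∀ k : Fin (d + 1) → ZMod (2 * L),
      HasMaj (BlockNorm.ofBlocks (unitTorusGeo L kk M) (fun b : Tor (fine (L ^ kk) M) × Fin (d + 1) => blockOf (L ^ kk) M b.1))
        (BlockNorm.ofBlocks (unitTorusGeo L kk M) (fun b : Tor (fine (L ^ kk) M) × Fin (d + 1) => blockOf (L ^ kk) M b.1))
        (mulOp (chiCube M (L ^ kk) (coverCorner M (L ^ m) L (coverMargin L m) k) (L * L ^ m)) ∘ₗ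
          (fgrad ((L ^ kk : ℕ) : ℝ) (bshiftEquiv M (L ^ kk) μ) ∘ₗ knitG d L m kk (L ^ kk) hL a k))
        (fun y y' => ind ((cubeBlocks M (coverCorner M (L ^ m) L (coverMargin L m) k) (L * L ^ m) : Finset (Tor M)) : Set (Tor M)) y *
          ind ((cubeBlocks M (coverCorner M (L ^ m) L (coverMargin L m) k) (L * L ^ m) : Finset (Tor M)) : Set (Tor M)) y' * (β₁ * Real.exp (-(δ * tdistT M y y')))) :=
    fun k => by
    have h := HD (m + 1) kk hk (coverCorner M (L ^ m) L (coverMargin L m) k) μ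
    rw [hSe, symbOp_sD_eq] at h
    exact (hasMaj_rate_le (hind k) hβD.le hdD h).mono fun y y' =>
      mul_le_mul_of_nonneg_left (mul_le_mul_of_nonneg_right (le_max_left _ _) (Real.exp_nonneg _)) (hind k y y')
  have hDGc' : ∀ k : Fin (d + 1) → ZMod (2 * L),
      HasMaj (BlockNorm.ofBlocks (unitTorusGeo L kk M) ((fun b : Tor (fine (L ^ kk) M) × Fin (d + 1) => blockOf (L ^ kk) M b.1) ∘ kingPrV L kk r M))
        (BlockNorm.ofBlocks (unitTorusGeo L kk M) ((fun b : Tor (fine (L ^ kk) M) × Fin (d + 1) => blockOf (L ^ kk) M b.1) ∘ kingPrV L kk r M))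
        (mulOp (chiCube M (L ^ r * L ^ kk) (coverCorner M (L ^ m) L (coverMargin L m) k) (L * L ^ m)) ∘ₗ
          (fgrad ((L ^ r * L ^ kk : ℕ) : ℝ) (bshiftEquiv M (L ^ r * L ^ kk) μ) ∘ₗ knitG d L m kk (L ^ r * L ^ kk) hL a k))
        (fun y y' => ind ((cubeBlocks M (coverCorner M (L ^ m) L (coverMargin L m) k) (L * L ^ m) : Finset (Tor M)) : Set (Tor M)) y *
          ind ((cubeBlocks M (coverCorner M (L ^ m) L (coverMargin L m) k) (L * L ^ m) : Finset (Tor M)) : Set (Tor M)) y' * (β₁ * Real.exp (-(δ * tdistT M y y')))) :=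
    fun k => by
    have h := HD' (m + 1) kk r hk (coverCorner M (L ^ m) L (coverMargin L m) k) μ
    rw [hSe, symbOp_sD_eq] at h
    rw [← hblk]
    exact (hasMaj_rate_le (hind k) hβD'.le hdD' h).mono fun y y' =>
      mul_le_mul_of_nonneg_left (mul_le_mul_of_nonneg_right (le_max_right _ _) (Real.exp_nonneg _)) (hind k y y')
  -- cut defects
  have hIGc : ∀ k : Fin (d + 1) → ZMod (2 * L),
      HasMaj (BlockNorm.ofBlocks (unitTorusGeo L kk M) (fun b : Tor (fine (L ^ kk) M) × Fin (d + 1) => blockOf (L ^ kk) M b.1))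
        (BlockNorm.ofBlocks (unitTorusGeo L kk M) ((fun b : Tor (fine (L ^ kk) M) × Fin (d + 1) => blockOf (L ^ kk) M b.1) ∘ kingPrV L kk r M))
        (idef (pull (kingPrV L kk r M)) (pull (kingPrV L kk r M))
          (mulOp (chiCube M (L ^ r * L ^ kk) (coverCorner M (L ^ m) L (coverMargin L m) k) (L * L ^ m)) ∘ₗ knitG d L m kk (L ^ r * L ^ kk) hL a k)
          (mulOp (chiCube M (L ^ kk) (coverCorner M (L ^ m) L (coverMargin L m) k) (L * L ^ m)) ∘ₗ knitG d L m kk (L ^ kk) hL a k))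
        (fun y y' => ind ((cubeBlocks M (coverCorner M (L ^ m) L (coverMargin L m) k) (L * L ^ m) : Finset (Tor M)) : Set (Tor M)) y *
          ind ((cubeBlocks M (coverCorner M (L ^ m) L (coverMargin L m) k) (L * L ^ m) : Finset (Tor M)) : Set (Tor M)) y' * (mc * ε * Real.exp (-(δ * tdistT M y y')))) := fun k => by
    have h := HC (m + 1) kk r hk hL (coverCorner M (L ^ m) L (coverMargin L m) k)
    rw [hSe, hexp16] at h
    have h2 := hasMaj_rate_le (hind k) (by positivity : 0 ≤ mc * ε) hdc h
    rw [hblk] at h2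
    exact h2
  have hIDGc : ∀ k : Fin (d + 1) → ZMod (2 * L),
      HasMaj (BlockNorm.ofBlocks (unitTorusGeo L kk M) (fun b : Tor (fine (L ^ kk) M) × Fin (d + 1) => blockOf (L ^ kk) M b.1))
        (BlockNorm.ofBlocks (unitTorusGeo L kk M) ((fun b : Tor (fine (L ^ kk) M) × Fin (d + 1) => blockOf (L ^ kk) M b.1) ∘ kingPrV L kk r M))
        (idef (pull (kingPrV L kk r M)) (pull (kingPrV L kk r M))
          (mulOp (chiCube M (L ^ r * L ^ kk) (coverCorner M (L ^ m) L (coverMargin L m) k) (L * L ^ m)) ∘ₗ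
            (fgrad ((L ^ r * L ^ kk : ℕ) : ℝ) (bshiftEquiv M (L ^ r * L ^ kk) μ) ∘ₗ knitG d L m kk (L ^ r * L ^ kk) hL a k))
          (mulOp (chiCube M (L ^ kk) (coverCorner M (L ^ m) L (coverMargin L m) k) (L * L ^ m)) ∘ₗ
            (fgrad ((L ^ kk : ℕ) : ℝ) (bshiftEquiv M (L ^ kk) μ) ∘ₗ knitG d L m kk (L ^ kk) hL a k)))
        (fun y y' => ind ((cubeBlocks M (coverCorner M (L ^ m) L (coverMargin L m) k) (L * L ^ m) : Finset (Tor M)) : Set (Tor M)) y *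
          ind ((cubeBlocks M (coverCorner M (L ^ m) L (coverMargin L m) k) (L * L ^ m) : Finset (Tor M)) : Set (Tor M)) y' * (me * ε * Real.exp (-(δ * tdistT M y y')))) := fun k => by
    have h := HE (m + 1) kk r hk hn4 hL (coverCorner M (L ^ m) L (coverMargin L m) k) μ
    rw [hSe, symbOp_sD_eq, symbOp_sD_eq] at h
    have h2 := hasMaj_rate_le (hind k) (by positivity : 0 ≤ me * ε) hde h
    rw [hblk] at h2
    exact h2
  -- the partition: Leibniz at both spacings, cuts, sizes, fits, overlap
  have hχ := fun ν k => chiCube_coverCorner_eq_one_side (M := M) (n := L ^ kk) (m₀ := coverMargin L m) hM hw hfit1 hS ν k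
  have hχ' := fun ν k => chiCube_coverCorner_eq_one_side (M := M) (n := L ^ r * L ^ kk) (m₀ := coverMargin L m) hM hw hfit1 hS ν k
  have hleib : ∀ k : Fin (d + 1) → ZMod (2 * L), fgrad ((L ^ kk : ℕ) : ℝ) (bshiftEquiv M (L ^ kk) μ) ∘ₗ mulOp (knitH d L m kk (L ^ kk) hL k) =
      mulOp (knitH d L m kk (L ^ kk) hL k ∘ ⇑(bshiftEquiv M (L ^ kk) μ)) ∘ₗ fgrad ((L ^ kk : ℕ) : ℝ) (bshiftEquiv M (L ^ kk) μ) +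
        mulOp (fgrad ((L ^ kk : ℕ) : ℝ) (bshiftEquiv M (L ^ kk) μ) (knitH d L m kk (L ^ kk) hL k)) := fun k => fgrad_comp_mulOp _ _ _
  have hleib' : ∀ k : Fin (d + 1) → ZMod (2 * L), fgrad ((L ^ r * L ^ kk : ℕ) : ℝ) (bshiftEquiv M (L ^ r * L ^ kk) μ) ∘ₗ mulOp (knitH d L m kk (L ^ r * L ^ kk) hL k) =
      mulOp (knitH d L m kk (L ^ r * L ^ kk) hL k ∘ ⇑(bshiftEquiv M (L ^ r * L ^ kk) μ)) ∘ₗ fgrad ((L ^ r * L ^ kk : ℕ) : ℝ) (bshiftEquiv M (L ^ r * L ^ kk) μ) +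
        mulOp (fgrad ((L ^ r * L ^ kk : ℕ) : ℝ) (bshiftEquiv M (L ^ r * L ^ kk) μ) (knitH d L m kk (L ^ r * L ^ kk) hL k)) := fun k => fgrad_comp_mulOp _ _ _
  have hcuts := fun k : Fin (d + 1) → ZMod (2 * L) => coverH_shift_cut (n := L ^ kk) (m₀ := coverMargin L m) hM hw hfit1 hS μ k
  have hcutd := fun k : Fin (d + 1) → ZMod (2 * L) => fgrad_hcube_cut (2 * L) (coverXi M (L ^ kk) (L ^ m)) (bshiftEquiv M (L ^ kk)) μ ((L ^ kk : ℕ) : ℝ) (hχ μ k)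
  have hcuts' := fun k : Fin (d + 1) → ZMod (2 * L) => coverH_shift_cut (n := L ^ r * L ^ kk) (m₀ := coverMargin L m) hM hw hfit1 hS μ k
  have hcutd' := fun k : Fin (d + 1) → ZMod (2 * L) =>
    fgrad_hcube_cut (2 * L) (coverXi M (L ^ r * L ^ kk) (L ^ m)) (bshiftEquiv M (L ^ r * L ^ kk)) μ ((L ^ r * L ^ kk : ℕ) : ℝ) (hχ' μ k)
  have hh : ∀ (k : Fin (d + 1) → ZMod (2 * L)) x, |knitH d L m kk (L ^ kk) hL k x| ≤ 1 := fun k x => abs_coverH_le_one k x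
  have hhs' : ∀ (k : Fin (d + 1) → ZMod (2 * L)) x', |(knitH d L m kk (L ^ r * L ^ kk) hL k ∘ ⇑(bshiftEquiv M (L ^ r * L ^ kk) μ)) x'| ≤ 1 :=
    fun k x' => abs_coverH_le_one k (bshiftEquiv M (L ^ r * L ^ kk) μ x')
  have hdh' : ∀ (k : Fin (d + 1) → ZMod (2 * L)) x', |fgrad ((L ^ r * L ^ kk : ℕ) : ℝ) (bshiftEquiv M (L ^ r * L ^ kk) μ) (knitH d L m kk (L ^ r * L ^ kk) hL k) x'| ≤
      π / ((L ^ m : ℕ) : ℝ) := fun k x' => abs_fgrad_coverH_le hM hw k μ x'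
  have hfitH : ∀ (k : Fin (d + 1) → ZMod (2 * L)) x', |knitH d L m kk (L ^ r * L ^ kk) hL k x' - knitH d L m kk (L ^ kk) hL k (kingPrV L kk r M x')| ≤
      π * (d + 1) / (((L ^ kk : ℕ) : ℝ) * ((L ^ m : ℕ) : ℝ)) := fun k x' => abs_coverH_fine_sub_le (L := L) (kk := kk) (r := r) hM hw k x'
  have hfits : ∀ (k : Fin (d + 1) → ZMod (2 * L)) x', |(knitH d L m kk (L ^ r * L ^ kk) hL k ∘ ⇑(bshiftEquiv M (L ^ r * L ^ kk) μ)) x' -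
      (knitH d L m kk (L ^ kk) hL k ∘ ⇑(bshiftEquiv M (L ^ kk) μ)) (kingPrV L kk r M x')| ≤
      π * (d + 1) / (((L ^ kk : ℕ) : ℝ) * ((L ^ m : ℕ) : ℝ)) + π / ((L ^ m : ℕ) : ℝ) / ((L ^ r * L ^ kk : ℕ) : ℝ) + π / ((L ^ m : ℕ) : ℝ) / ((L ^ kk : ℕ) : ℝ) :=
    fun k x' => abs_coverH_shift_fine_sub_le (L := L) (kk := kk) (r := r) hM hw k μ x'
  obtain ⟨hs0, hs13, hs1', hs1, hsL, hnκ, hnκ'⟩ := coverFit_params (L := L) (kk := kk) (r := r) (w := L ^ m) hL1 hw h3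
  have hξ := fun ν ν' b => coverXi_shift (n := L ^ kk) hM hw ν ν' b
  have hξ' := fun ν ν' b => coverXi_shift (n := L ^ r * L ^ kk) hM hw ν ν' b
  have hoff := fun ν x' => coverXi_offset (M := M) (L := L) (kk := kk) (r := r) (w := L ^ m) (q := L) ν x'
  have hK2 : 2 ≤ 2 * L := by omega
  have hLr : 1 ≤ L ^ r := Nat.one_le_pow _ _ hLpos
  have hfitd : ∀ (k : Fin (d + 1) → ZMod (2 * L)) x', |fgrad ((L ^ r * L ^ kk : ℕ) : ℝ) (bshiftEquiv M (L ^ r * L ^ kk) μ) (knitH d L m kk (L ^ r * L ^ kk) hL k) x' -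
      fgrad ((L ^ kk : ℕ) : ℝ) (bshiftEquiv M (L ^ kk) μ) (knitH d L m kk (L ^ kk) hL k) (kingPrV L kk r M x')| ≤
      |((((L ^ m : ℕ) : ℝ)))⁻¹| * (((L ^ kk : ℕ) : ℝ) * ((L ^ m : ℕ) : ℝ))⁻¹ * (64 * π ^ 2 + π ^ 2 * Fintype.card (Fin (d + 1))) := fun k x' =>
    abs_fgrad_hcube_two_grid_le (2 * L) (coverXi M (L ^ kk) (L ^ m)) (coverXi M (L ^ r * L ^ kk) (L ^ m)) (kingPrV L kk r M) (bshiftEquiv M (L ^ kk))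
      (bshiftEquiv M (L ^ r * L ^ kk)) hK2 hLr hs0 hs1' hsL hnκ hnκ' hξ hξ' hoff k μ x'
  have hN := fun y => sum_ind_cubeBlocks_le (M := M) (w := L ^ m) (q := L) (m₀ := coverMargin L m) L kk y
  -- FILE 83
  have key := hasMaj_idef_comp_parametrix_cut (g := unitTorusGeo L kk M) (fun b : Tor (fine (L ^ kk) M) × Fin (d + 1) => blockOf (L ^ kk) M b.1) (kingPrV L kk r M)
    (fun k => ((cubeBlocks M (coverCorner M (L ^ m) L (coverMargin L m) k) (L * L ^ m) : Finset (Tor M)) : Set (Tor M)))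
    (D := fgrad ((L ^ kk : ℕ) : ℝ) (bshiftEquiv M (L ^ kk) μ)) (D' := fgrad ((L ^ r * L ^ kk : ℕ) : ℝ) (bshiftEquiv M (L ^ r * L ^ kk) μ))
    (G := knitG d L m kk (L ^ kk) hL a) (G' := knitG d L m kk (L ^ r * L ^ kk) hL a)
    hβ hβ₁ zero_le_one (by positivity : (0 : ℝ) ≤ π / ((L ^ m : ℕ) : ℝ)) (by positivity) (by positivity) (by positivity) (by positivity : 0 ≤ mc * ε)
    (by positivity : 0 ≤ me * ε) hleib hleib' hcuts hcutd hcuts' hcutd' hh hhs' hdh' hfitH hfits hfitd hN hGc hGc' hDGc hDGc' hIGc hIDGc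
  rw [← hblk] at key
  refine key.mono fun y y' => mul_le_mul_of_nonneg_right ?_ (Real.exp_nonneg _)
  -- the compression
  clear key hIDGc hIGc hDGc' hDGc hGc' hGc hG hG' hleib hleib' hcuts hcutd hcuts' hcutd' hh hhs' hdh' hfitH hfits hfitd hN hξ hξ' hoff hχ hχ' HE HC HD HD' H hblk hind
  rw [Fintype.card_fin]
  have hwpos : (0 : ℝ) < ((L ^ m : ℕ) : ℝ) := by linarith
  have hnpos : (0 : ℝ) < ((L ^ kk : ℕ) : ℝ) := by linarith
  have hcdπ : π / ((L ^ m : ℕ) : ℝ) ≤ π := div_le_self Real.pi_pos.le hwR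
  have ho : π * (d + 1) / (((L ^ kk : ℕ) : ℝ) * ((L ^ m : ℕ) : ℝ)) ≤ Ko * ε := by
    rw [div_eq_mul_inv]; exact mul_le_mul_of_nonneg_left hnwε (by positivity)
  have hπw : π / ((L ^ m : ℕ) : ℝ) / ((L ^ kk : ℕ) : ℝ) ≤ π * ε := by
    rw [div_div, div_eq_mul_inv, mul_comm ((L ^ m : ℕ) : ℝ)]
    exact mul_le_mul_of_nonneg_left hnwε Real.pi_pos.le
  have hπw' : π / ((L ^ m : ℕ) : ℝ) / ((L ^ r * L ^ kk : ℕ) : ℝ) ≤ π * ε := by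
    refine le_trans ?_ hπw
    exact div_le_div_of_nonneg_left (by positivity) hnpos hnn'
  have hos : π * (d + 1) / (((L ^ kk : ℕ) : ℝ) * ((L ^ m : ℕ) : ℝ)) + π / ((L ^ m : ℕ) : ℝ) / ((L ^ r * L ^ kk : ℕ) : ℝ) + π / ((L ^ m : ℕ) : ℝ) / ((L ^ kk : ℕ) : ℝ) ≤
      Kos * ε := by
    calc _ ≤ Ko * ε + π * ε + π * ε := add_le_add (add_le_add ho hπw') hπw
      _ = Kos * ε := by rw [hKos_def, hKo_def]; ring
  have hod : |((((L ^ m : ℕ) : ℝ)))⁻¹| * (((L ^ kk : ℕ) : ℝ) * ((L ^ m : ℕ) : ℝ))⁻¹ * (64 * π ^ 2 + π ^ 2 * (d + 1 : ℕ)) ≤ Kod * ε := by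
    rw [abs_of_pos (inv_pos.mpr hwpos)]
    have t : (((L ^ m : ℕ) : ℝ))⁻¹ * (((L ^ kk : ℕ) : ℝ) * ((L ^ m : ℕ) : ℝ))⁻¹ ≤ 1 * ε := mul_le_mul hw1 hnwε (by positivity) zero_le_one
    rw [one_mul] at t
    calc (((L ^ m : ℕ) : ℝ))⁻¹ * (((L ^ kk : ℕ) : ℝ) * ((L ^ m : ℕ) : ℝ))⁻¹ * (64 * π ^ 2 + π ^ 2 * (d + 1 : ℕ))
        ≤ ε * (64 * π ^ 2 + π ^ 2 * (d + 1 : ℕ)) := mul_le_mul_of_nonneg_right t (by positivity)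
      _ = Kod * ε := by rw [hKod_def]; ring
  have hcomp := entryOneDefectConst_le (me := me) (by positivity : 0 ≤ Nov) hβ hβ₁ hcdπ (by positivity) hε0 hmc.le ho hos hod
  refine hcomp.trans ?_
  rw [hD_def, add_mul _ (1 : ℝ) ε, one_mul]
  exact le_add_of_nonneg_right hε0

end TwoGrid

end Summit.QuantumFields.YangMills.BalabanUVNodes.N15.Gluing

end
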